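import Literature.NumberTheory.LFunctions.Zhang2022.Section9PartialSummation
import Literature.NumberTheory.LFunctions.Zhang2022.RepairGapSection9GatheringPremise
import Literature.NumberTheory.LFunctions.Zhang2022.RepairGapPartIIIDoors
import HarnessLib

/-!
# Zhang (2022), rescue GAP/BED (D-0124 (3)(4)): §9 p. 51 — node Z22:§9.u004 (reading (r), `Section9Statements.Step9u004r`,
# the §9 input of the (9.7) evaluation) under the minimum premise `‖L(1,χ)‖ ≤ 𝓛⁻¹⁵`, UNCONDITIONAL

Topic `Literature/NumberTheory/LFunctions/Zhang2022` (Landau–Siegel audit tree; verdict-neutral).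
Y. Zhang, *Discrete mean estimates and the Landau–Siegel zero*, arXiv:2211.02515v1 (2022)
[Zhang2022LandauSiegel] — **an unrefereed manuscript under adjudication; nothing in this file asserts or
denies its Theorems 1–2, and nothing here is a claim about Landau–Siegel zeros. The programme SEARCHES and
TYPES; no claim about Landau–Siegel zeros, Theorems 1–2 of arXiv:2211.02515 or a repaired Margin232 until a
kernel theorem says so.**

The whole-DAG binder `h9u004r : Section9Statements.Step9u004r c′` («`S_j(𝐚₁₂,𝐚₂₂) = 𝔞∫₁^{P₃}(…)(…)dx/x +
|ι₄|²𝔞(log P₂)⁻²∫_{P₃}^{P₂}𝔣_{j7}𝔤_{j7}(P₂/x)dx/x + o(α)`», §9 p. 51) is a tree theorem (`Skeleton.step9u004r_of_lemma84Rel`) from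
the gathering (G9) and the partial summation (PS9) through `Section9FrontEndExact.step9u004r_of_parts`; Assumption (A) is only
THREADED ((PS9) binds it and does not use it). With (G9) kernel at exponent 15 (`Section9Gathering.gathering9_pow15`,
`RepairGapSection9GatheringPremise`), this file re-runs (PS9), the substitution glue and the final edge VERBATIM with the guard
text swapped: `Section9PartialSummation.ps9_pow15`, `Section9FrontEndExact.substituted_of_gathered_pow15`,
**`Section9FrontEndExact.step9u004r_of_parts_pow15`** (conclusion = the body of `Step9u004r c′` with guard `‖L(1,χ)‖ ≤ 𝓛⁻¹⁵`),
and **`Section9Gathering.step9u004r_pow15` — node §9.u004 at (A)-exponent 15, every `c′ ≥ 0`, UNCONDITIONAL**, plus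
`step9u004r_of_assumptionAWith` (every real `E ≥ 15`; at `E = 2022` the body of the tree theorem, not restated).
GAP reading (as-typed): the §9 main-term input of node (9.7) is kernel at E = 15; (9.7) itself (`Eval97With`) also consumes
(9.1) = `Eq91` (from Prop 2.2 / Lemma 2.3 / Lemma 8.1 — Part I) and Prop 7.1, so the NODE stays at the printed exponent.
Theorems only; no definition, no named fact; nothing about (A) itself. Private helpers of `Section9PartialSummation` copied
(suffixed `_ps15`).

## References

* Y. Zhang, arXiv:2211.02515v1 (2022), §9 p. 51 (tex L2598–L2618); §8 pp. 47–48. [cite: Zhang2022LandauSiegel, §9 p.51]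
-/

noncomputable section

open Complex Real ComplexConjugate Set MeasureTheory Finset

/-! ## (PS9) at `𝓛⁻¹⁵` -/

namespace Literature.NumberTheory.LFunctions.Zhang2022.Section9PartialSummation

open Skeleton Section8AbelProfiles Section8RangeEngine

/-- `3 ≤ 𝓛` once `D ≥ 21`. [cite: Zhang2022LandauSiegel, §2 (2.1)] -/
private theorem four_le_ell_ps15 {D : ℕ} (hD : ⌈Real.exp 4⌉₊ ≤ D) : 4 ≤ ell D := by
  have hexp : Real.exp 4 ≤ D := le_trans (Nat.le_ceil _) (by exact_mod_cast hD)
  rw [ell]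
  exact (Real.le_log_iff_exp_le (lt_of_lt_of_le (Real.exp_pos _) hexp)).mpr hexp

/-- `c ≤ 𝓛` once `D ≥ ⌈e^c⌉`. [cite: Zhang2022LandauSiegel, §2 (2.1)] -/
private theorem le_ell_of_le_ps15' {c : ℝ} {D : ℕ} (hD : ⌈Real.exp c⌉₊ ≤ D) : c ≤ ell D := by
  have hexp : Real.exp c ≤ D := le_trans (Nat.le_ceil _) (by exact_mod_cast hD)
  rw [ell]
  exact (Real.le_log_iff_exp_le (lt_of_lt_of_le (Real.exp_pos _) hexp)).mpr hexp

/-- `‖ι₃‖ + ‖ι₄‖ ≤ 3.53` ((2.26): `ι₃ = −1.00635 − 0.22789i`, `ι₄ = −0.68738 + 1.60688i`; `‖z‖ ≤ |Re z| + |Im z|`).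
[cite: Zhang2022LandauSiegel, §2 (2.26)] -/
private theorem norm_iota34_le_ps15 : ‖iota3‖ + ‖iota4‖ ≤ 3.53 := by
  have h3 := Complex.norm_le_abs_re_add_abs_im iota3
  have h4 := Complex.norm_le_abs_re_add_abs_im iota4
  have r3 : iota3.re = -1.00635 := by simp [iota3]
  have i3 : iota3.im = -0.22789 := by simp [iota3]
  have r4 : iota4.re = -0.68738 := by simp [iota4]
  have i4 : iota4.im = 1.60688 := by simp [iota4]
  rw [r3, i3] at h3; rw [r4, i4] at h4
  norm_num at h3 h4
  linarith

/-- The scale facts for `𝓛 ≥ 4`: `log P₃ = 0.498𝓛⁹`, `0.498𝓛⁹ ≤ log P₂ ≤ 0.5𝓛⁹`, `2 ≤ P₃ ≤ P₂ ≤ P`.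
[cite: Zhang2022LandauSiegel, §2 (2.6), (2.21)] -/
private theorem scale_facts_ps15 {D : ℕ} (hℓ : 4 ≤ ell D) :
    Real.log (Skeleton.P3 D) = 0.498 * ell D ^ 9 ∧
      0.498 * ell D ^ 9 ≤ Real.log (Skeleton.P2 D) ∧ Real.log (Skeleton.P2 D) ≤ 0.5 * ell D ^ 9 ∧
      2 ≤ Skeleton.P3 D ∧ Skeleton.P3 D ≤ Skeleton.P2 D ∧ Skeleton.P2 D ≤ bigP D := by
  have h1 : 1 ≤ ell D := by linarith
  have hP : 0 < bigP D := Real.exp_pos _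
  have hT : 0 < bigT D := Real.exp_pos _
  have hP3pos : 0 < Skeleton.P3 D := Real.rpow_pos_of_pos hP _
  have hP2pos : 0 < Skeleton.P2 D := div_pos (Real.rpow_pos_of_pos hP _) (pow_pos hT _)
  have e3 : Real.log (Skeleton.P3 D) = 0.498 * ell D ^ 9 := by
    rw [Skeleton.P3, Real.log_rpow hP, log_bigP]
  have e2 : Real.log (Skeleton.P2 D) = 0.5 * ell D ^ 9 - 10 * ell D ^ (1.1 : ℝ) := by
    rw [Skeleton.P2, Real.log_div (Real.rpow_pos_of_pos hP _).ne' (pow_pos hT _).ne',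
      Real.log_rpow hP, log_bigP, Real.log_pow, bigT, Real.log_exp]
    push_cast; ring
  have hr0 : 0 ≤ ell D ^ (1.1 : ℝ) := Real.rpow_nonneg (by linarith) _
  have hr2 : ell D ^ (1.1 : ℝ) ≤ ell D ^ 2 := by
    have := Real.rpow_le_rpow_of_exponent_le h1 (by norm_num : (1.1 : ℝ) ≤ 2)
    rwa [Real.rpow_two] at this
  have h7 : (4:ℝ) ^ 7 ≤ ell D ^ 7 := pow_le_pow_left₀ (by norm_num) hℓ 7
  have h9 : (4:ℝ) ^ 9 ≤ ell D ^ 9 := pow_le_pow_left₀ (by norm_num) hℓ 9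
  have h10 : 10 * ell D ^ 2 ≤ 0.002 * ell D ^ 9 := by
    rw [show ell D ^ 9 = ell D ^ 2 * ell D ^ 7 by ring]
    nlinarith [pow_nonneg (by linarith : (0:ℝ) ≤ ell D) 2]
  have hlo : 0.498 * ell D ^ 9 ≤ Real.log (Skeleton.P2 D) := by rw [e2]; linarith
  have hhi : Real.log (Skeleton.P2 D) ≤ 0.5 * ell D ^ 9 := by rw [e2]; linarith
  refine ⟨e3, hlo, hhi, ?_, ?_, ?_⟩
  · -- `2 ≤ P₃`: `log 2 ≤ 1 ≤ 0.498𝓛⁹`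
    have h2 : Real.log 2 ≤ Real.log (Skeleton.P3 D) := by
      rw [e3]; have := Real.log_two_lt_d9; nlinarith
    exact (Real.log_le_log_iff (by norm_num) hP3pos).mp h2
  · exact (Real.log_le_log_iff hP3pos hP2pos).mp (by rw [e3]; exact hlo)
  · rw [← Real.log_le_log_iff hP2pos hP, log_bigP]
    nlinarith

/-- `κ₉ = ‖ι₃‖/log P₃ + ‖ι₄‖/log P₂ ≤ 10𝓛⁻⁹` for `𝓛 ≥ 4`. [cite: Zhang2022LandauSiegel, §2 (2.21), (2.26)] -/
private theorem kappa9_le_ps15 {ℓ L3 L2 : ℝ} (hℓ : 4 ≤ ℓ) (hL3 : L3 = 0.498 * ℓ ^ 9) (hL2 : 0.498 * ℓ ^ 9 ≤ L2) :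
    ‖iota3‖ / L3 + ‖iota4‖ / L2 ≤ 10 / ℓ ^ 9 := by
  have h9 : 0 < ℓ ^ 9 := by positivity
  have hL3pos : 0 < L3 := by rw [hL3]; positivity
  have hL2pos : 0 < L2 := lt_of_lt_of_le (by positivity) hL2
  have hι := norm_iota34_le_ps15
  have h3 : ‖iota3‖ / L3 ≤ ‖iota3‖ / (0.498 * ℓ ^ 9) := by rw [hL3]
  have h4 : ‖iota4‖ / L2 ≤ ‖iota4‖ / (0.498 * ℓ ^ 9) :=
    div_le_div_of_nonneg_left (norm_nonneg _) (by positivity) hL2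
  have h5 : ‖iota3‖ / (0.498 * ℓ ^ 9) + ‖iota4‖ / (0.498 * ℓ ^ 9) ≤ 10 / ℓ ^ 9 := by
    rw [← add_div, div_le_div_iff₀ (by positivity) h9]
    nlinarith [norm_nonneg iota3, norm_nonneg iota4]
  linarith

/-- `α log(P₂ + 1) ≤ 4` (`α = π/𝓛⁹`, `log P₂ ≤ 0.5𝓛⁹`, `𝓛 ≥ 4`). [cite: Zhang2022LandauSiegel, §2 (2.10), (2.21)] -/
private theorem alpha_log_succ_P2_le_ps15 {ℓ P2 : ℝ} (hℓ : 4 ≤ ℓ) (hP2 : 1 ≤ P2)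
    (hlog : Real.log P2 ≤ 0.5 * ℓ ^ 9) : π / ℓ ^ 9 * Real.log (P2 + 1) ≤ 4 := by
  have h9 : 0 < ℓ ^ 9 := by positivity
  have h9' : (4 : ℝ) ^ 9 ≤ ℓ ^ 9 := pow_le_pow_left₀ (by norm_num) hℓ 9
  have hP0 : 0 < P2 := by linarith
  have hlog2 : Real.log (P2 + 1) ≤ 1 + 0.5 * ℓ ^ 9 := by
    have h1 : P2 + 1 ≤ 2 * P2 := by linarith
    have h2 : Real.log (P2 + 1) ≤ Real.log (2 * P2) := Real.log_le_log (by linarith) h1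
    rw [Real.log_mul (by norm_num) hP0.ne'] at h2
    have h3 : Real.log 2 ≤ 1 := by have := Real.log_two_lt_d9; linarith
    linarith
  have hπ4 : π ≤ 4 := by have := Real.pi_lt_d2; linarith
  rw [div_mul_eq_mul_div, div_le_iff₀ h9]
  have hlog0 : 0 ≤ Real.log (P2 + 1) := Real.log_nonneg (by linarith)
  calc π * Real.log (P2 + 1) ≤ 4 * (1 + 0.5 * ℓ ^ 9) := by nlinarith [Real.pi_pos]
    _ ≤ 4 * ℓ ^ 9 := by nlinarith

/-- The engine error for a product profile with bounds `29κ·146κ`, `(94ακ·146κ + 29κ·449ακ)/t`: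
`C𝓛⁶(M + M′𝓛⁹) ≤ |C|(423400 + 2674500π)𝓛⁻¹²` for `κ ≤ 10𝓛⁻⁹`, `α = π𝓛⁻⁹` (d29's `errF_le_ps15`, private copy).
[cite: Zhang2022LandauSiegel, §8 (8.11) p.48] -/
private theorem errF_le_ps15 {ℓ κ C : ℝ} (hℓ : 3 ≤ ℓ) (hκ0 : 0 ≤ κ) (hκ : κ ≤ 10 / ℓ ^ 9) :
    C * ℓ ^ 6 * (29 * κ * (146 * κ) +
        (94 * (π / ℓ ^ 9) * κ * (146 * κ) + 29 * κ * (449 * (π / ℓ ^ 9) * κ)) * ℓ ^ 9) ≤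
      |C| * (423400 + 2674500 * π) / ℓ ^ 12 := by
  have hℓ0 : 0 < ℓ := by linarith
  have h9 : 0 < ℓ ^ 9 := by positivity
  have hκ2 : κ ^ 2 ≤ 100 / ℓ ^ 18 := by
    calc κ ^ 2 ≤ (10 / ℓ ^ 9) ^ 2 := pow_le_pow_left₀ hκ0 hκ 2
      _ = 100 / ℓ ^ 18 := by rw [div_pow]; ring
  have e : C * ℓ ^ 6 * (29 * κ * (146 * κ) +
        (94 * (π / ℓ ^ 9) * κ * (146 * κ) + 29 * κ * (449 * (π / ℓ ^ 9) * κ)) * ℓ ^ 9) =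
      C * ((4234 + 26745 * π) * (ℓ ^ 6 * κ ^ 2)) := by
    field_simp
    ring
  rw [e]
  have hx0 : 0 ≤ (4234 + 26745 * π) * (ℓ ^ 6 * κ ^ 2) := by positivity
  have hx : (4234 + 26745 * π) * (ℓ ^ 6 * κ ^ 2) ≤ (423400 + 2674500 * π) / ℓ ^ 12 := by
    have h1 : ℓ ^ 6 * κ ^ 2 ≤ ℓ ^ 6 * (100 / ℓ ^ 18) := mul_le_mul_of_nonneg_left hκ2 (by positivity)
    have h2 : ℓ ^ 6 * (100 / ℓ ^ 18) = 100 / ℓ ^ 12 := by field_simp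
    calc (4234 + 26745 * π) * (ℓ ^ 6 * κ ^ 2) ≤ (4234 + 26745 * π) * (100 / ℓ ^ 12) := by
          rw [← h2]; exact mul_le_mul_of_nonneg_left h1 (by positivity)
      _ = (423400 + 2674500 * π) / ℓ ^ 12 := by ring
  calc C * ((4234 + 26745 * π) * (ℓ ^ 6 * κ ^ 2)) ≤ |C| * ((4234 + 26745 * π) * (ℓ ^ 6 * κ ^ 2)) :=
        mul_le_mul_of_nonneg_right (le_abs_self C) hx0
    _ ≤ |C| * ((423400 + 2674500 * π) / ℓ ^ 12) := mul_le_mul_of_nonneg_left hx (abs_nonneg C)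
    _ = |C| * (423400 + 2674500 * π) / ℓ ^ 12 := by ring

/-- `|C|·Q·𝓛⁻¹² ≤ (ε/2)α` once `𝓛 ≥ 2|C|Q/(επ)` (`α = π𝓛⁻⁹`, `𝓛 ≥ 3`; d29's `total_err_le_ps15`, private copy).
[cite: Zhang2022LandauSiegel, §8 (8.11) p.48] -/
private theorem total_err_le_ps15 {ℓ C Q ε : ℝ} (hℓ : 3 ≤ ℓ) (hε : 0 < ε) (_hQ : 0 ≤ Q)
    (hCQ : 2 * |C| * Q / (ε * π) ≤ ℓ) : |C| * Q / ℓ ^ 12 ≤ ε / 2 * (π / ℓ ^ 9) := by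
  have hℓ0 : 0 < ℓ := by linarith
  have hℓ1 : 1 ≤ ℓ := by linarith
  have h3 : ℓ ≤ ℓ ^ 3 := le_self_pow₀ hℓ1 (by norm_num)
  have hCQ' : 2 * |C| * Q ≤ ε * π * ℓ ^ 3 := by
    have := (div_le_iff₀ (by positivity)).mp hCQ
    nlinarith [this, h3, mul_pos hε Real.pi_pos]
  rw [div_le_iff₀ (by positivity)]
  have e : ε / 2 * (π / ℓ ^ 9) * ℓ ^ 12 = ε * π * ℓ ^ 3 / 2 := by field_simp
  rw [e]
  linarith

set_option maxHeartbeats 400000 in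
/-- **(PS9) UNDER THE GUARD `‖L(1,χ)‖ ≤ 𝓛⁻¹⁵`** (twin of `ps9`, proof verbatim — the guard is bound and never used).
[cite: Zhang2022LandauSiegel, §9 p.51] -/
theorem ps9_pow15 (c' : ℝ) :
    ∀ ε : ℝ, 0 < ε → ForAllLarge fun D _ χ => ‖χ.LFunction 1‖ ≤ 1 / Real.log D ^ 15 →
      ∀ j ∈ ({1, 2, 3} : Finset ℕ),
        ‖(deriv χ.LFunction 1 ^ 2 *
                (∑ n ∈ Finset.Ico 1 ⌈Skeleton.P3 D⌉₊,
                  (‖χ (n : ZMod D)‖ : ℂ) * lamZero c' D j n / (Nat.totient n : ℂ) *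
                    ((conj iota3 * frakfW c' D j 6 (Skeleton.P3 D / n) / (Real.log (Skeleton.P3 D) : ℂ) +
                        conj iota4 * frakfW c' D j 7 (Skeleton.P2 D / n) / (Real.log (Skeleton.P2 D) : ℂ)) *
                      (iota3 * frakgW c' D j 6 (Skeleton.P3 D / n) / (Real.log (Skeleton.P3 D) : ℂ) +
                        iota4 * frakgW c' D j 7 (Skeleton.P2 D / n) / (Real.log (Skeleton.P2 D) : ℂ)))) +
              deriv χ.LFunction 1 ^ 2 *
                (∑ n ∈ Finset.Ico ⌈Skeleton.P3 D⌉₊ ⌈Skeleton.P2 D⌉₊,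
                  (‖χ (n : ZMod D)‖ : ℂ) * lamZero c' D j n / (Nat.totient n : ℂ) *
                    (conj iota4 * frakfW c' D j 7 (Skeleton.P2 D / n) / (Real.log (Skeleton.P2 D) : ℂ) *
                      (iota4 * frakgW c' D j 7 (Skeleton.P2 D / n) / (Real.log (Skeleton.P2 D) : ℂ))))) -
            (frakA χ : ℂ) * (Section9Statements.int9main c' D j +
              (Complex.normSq iota4 : ℂ) * Section9Statements.int9tail c' D j)‖ ≤ ε * alpha D := by
  intro ε hε
  obtain ⟨C, hE⟩ := weighted_sum_integral_eval c'
  set Q : ℝ := 3 * (423400 + 2674500 * π) with hQ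
  have hQ0 : 0 ≤ Q := by positivity
  have FL : ForAllLarge fun D _ _ =>
      4 ≤ ell D ∧ 5 * |c'| * π ≤ ell D ∧ 2 * |C| * Q / (ε * π) ≤ ell D :=
    ForAllLarge.of_le (max ⌈Real.exp 4⌉₊ (max ⌈Real.exp (5 * |c'| * π)⌉₊ ⌈Real.exp (2 * |C| * Q / (ε * π))⌉₊))
      fun D _ _ hD _ _ =>
        ⟨four_le_ell_ps15 (le_trans (le_max_left _ _) hD),
          le_ell_of_le_ps15' (le_trans ((le_max_left _ _).trans (le_max_right _ _)) hD),
          le_ell_of_le_ps15' (le_trans ((le_max_right _ _).trans (le_max_right _ _)) hD)⟩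
  refine (hE.and FL).mono ?_
  intro D _ χ hq hp h hA j hj
  obtain ⟨eng, hℓ4, hc5, hCQ⟩ := h
  replace eng := eng j hj
  -- parameters
  have hℓ3 : 3 ≤ ell D := by linarith
  have hℓ0 : 0 < ell D := by linarith
  have hℓ1 : 1 ≤ ell D := by linarith
  have h9 : 0 < ell D ^ 9 := by positivity
  have hα : alpha D = π / ell D ^ 9 := by rw [Skeleton.alpha, log_bigP]
  have hα0 : 0 < alpha D := by rw [hα]; positivity
  have hc : 5 * |c'| * alpha D * ell D ≤ 1 := by
    have h8 : ell D ≤ ell D ^ 8 := le_self_pow₀ hℓ1 (by norm_num)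
    have e : 5 * |c'| * alpha D * ell D = 5 * |c'| * π / ell D ^ 8 := by
      rw [hα]; field_simp
    rw [e, div_le_one (by positivity)]
    linarith
  obtain ⟨hL3, hL2lo, hL2hi, hP3two, hP32, hP2P⟩ := scale_facts_ps15 (D := D) hℓ4
  have hP3pos : 0 < Skeleton.P3 D := by linarith
  have hP2pos : 0 < Skeleton.P2 D := by linarith
  have hP2two : 2 ≤ Skeleton.P2 D := le_trans hP3two hP32
  have hP3P : Skeleton.P3 D ≤ bigP D := hP32.trans hP2P
  have hlogP3 : 0 < Real.log (Skeleton.P3 D) := by rw [hL3]; positivity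
  have hlogP2 : 0 < Real.log (Skeleton.P2 D) := lt_of_lt_of_le (by positivity) hL2lo
  set T : ℝ := Skeleton.P2 D + 1 with hT
  have hTα : alpha D * Real.log T ≤ 4 := by
    rw [hα]; exact alpha_log_succ_P2_le_ps15 hℓ4 (by linarith) hL2hi
  set L3 : ℝ := Real.log (Skeleton.P3 D) with hL3def
  set L2 : ℝ := Real.log (Skeleton.P2 D) with hL2def
  set κ : ℝ := ‖iota3‖ / L3 + ‖iota4‖ / L2 with hκ
  have hκ0 : 0 ≤ κ := by positivity
  have hκ10 : κ ≤ 10 / ell D ^ 9 := by rw [hκ]; exact kappa9_le_ps15 hℓ4 hL3 hL2lo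
  have hκ4 : ‖iota4‖ / L2 ≤ κ := by rw [hκ]; linarith [div_nonneg (norm_nonneg iota3) hlogP3.le]
  have hc3 : ‖conj iota3‖ = ‖iota3‖ := Complex.norm_conj _
  have hc4 : ‖conj iota4‖ = ‖iota4‖ := Complex.norm_conj _
  -- the two profiles and their bounds on `[1, T]`
  set FF : ℝ → ℂ := fun u =>
    (conj iota3 * frakfW c' D j 6 (Skeleton.P3 D / u) / (L3 : ℂ) +
        conj iota4 * frakfW c' D j 7 (Skeleton.P2 D / u) / (L2 : ℂ)) *
      (iota3 * frakgW c' D j 6 (Skeleton.P3 D / u) / (L3 : ℂ) +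
        iota4 * frakgW c' D j 7 (Skeleton.P2 D / u) / (L2 : ℂ)) with hFF
  set GG : ℝ → ℂ := fun u =>
    conj iota4 * frakfW c' D j 7 (Skeleton.P2 D / u) / (L2 : ℂ) *
      (iota4 * frakgW c' D j 7 (Skeleton.P2 D / u) / (L2 : ℂ)) with hGG
  have bF : ∀ t ∈ Set.Icc 1 T, DifferentiableAt ℝ FF t ∧ ‖FF t‖ ≤ 29 * κ * (146 * κ) ∧
      ‖deriv FF t‖ ≤ (94 * alpha D * κ * (146 * κ) + 29 * κ * (449 * alpha D * κ)) / t := by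
    intro t ht
    have hP3T : Skeleton.P3 D ≤ T := by rw [hT]; linarith
    have hP2T : Skeleton.P2 D ≤ T := by rw [hT]; linarith
    obtain ⟨dm, nm, nm'⟩ := mFac9_bounds c' j (conj iota3) (conj iota4) hα0 hℓ0.le hc
      (by linarith) (by linarith) hP3T hP2T ht.1 ht.2 hTα hlogP3 hlogP2
    obtain ⟨dn, nn, nn'⟩ := nFac9_bounds c' j iota3 iota4 hα0 hℓ0.le hc
      (by linarith) (by linarith) hP3T hP2T ht.1 ht.2 hTα hlogP3 hlogP2
    rw [hc3, hc4] at nm nm'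
    exact mul_bounds
      (f := fun w : ℝ => conj iota3 * frakfW c' D j 6 (Skeleton.P3 D / w) / (L3 : ℂ) +
        conj iota4 * frakfW c' D j 7 (Skeleton.P2 D / w) / (L2 : ℂ))
      (g := fun w : ℝ => iota3 * frakgW c' D j 6 (Skeleton.P3 D / w) / (L3 : ℂ) +
        iota4 * frakgW c' D j 7 (Skeleton.P2 D / w) / (L2 : ℂ))
      dm dn nm nn nm' nn' (by positivity)
  have bG : ∀ t ∈ Set.Icc 1 T, DifferentiableAt ℝ GG t ∧ ‖GG t‖ ≤ 29 * κ * (146 * κ) ∧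
      ‖deriv GG t‖ ≤ (94 * alpha D * κ * (146 * κ) + 29 * κ * (449 * alpha D * κ)) / t := by
    intro t ht
    have hP2T : Skeleton.P2 D ≤ T := by rw [hT]; linarith
    have ht0 : 0 < t := by linarith [ht.1]
    obtain ⟨dm, nm, nm'⟩ := sFacF_bounds c' j (conj iota4) hα0 hℓ0.le hc (by linarith) hP2T ht.1 ht.2 hTα hlogP2
    obtain ⟨dn, nn, nn'⟩ := sFacG_bounds c' j iota4 hα0 hℓ0.le hc (by linarith) hP2T ht.1 ht.2 hTα hlogP2
    rw [hc4] at nm nm'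
    have nm2 : ‖conj iota4 * frakfW c' D j 7 (Skeleton.P2 D / t) / (L2 : ℂ)‖ ≤ 29 * κ :=
      nm.trans (mul_le_mul_of_nonneg_left hκ4 (by norm_num))
    have nm2' : ‖deriv (fun w : ℝ => conj iota4 * frakfW c' D j 7 (Skeleton.P2 D / w) / (L2 : ℂ)) t‖ ≤
        94 * alpha D * κ / t :=
      nm'.trans (div_le_div_of_nonneg_right (mul_le_mul_of_nonneg_left hκ4 (by positivity)) ht0.le)
    have nn2 : ‖iota4 * frakgW c' D j 7 (Skeleton.P2 D / t) / (L2 : ℂ)‖ ≤ 146 * κ :=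
      nn.trans (mul_le_mul_of_nonneg_left hκ4 (by norm_num))
    have nn2' : ‖deriv (fun w : ℝ => iota4 * frakgW c' D j 7 (Skeleton.P2 D / w) / (L2 : ℂ)) t‖ ≤
        449 * alpha D * κ / t :=
      nn'.trans (div_le_div_of_nonneg_right (mul_le_mul_of_nonneg_left hκ4 (by positivity)) ht0.le)
    exact mul_bounds
      (f := fun w : ℝ => conj iota4 * frakfW c' D j 7 (Skeleton.P2 D / w) / (L2 : ℂ))
      (g := fun w : ℝ => iota4 * frakgW c' D j 7 (Skeleton.P2 D / w) / (L2 : ℂ))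
      dm dn nm2 nn2 nm2' nn2' (by positivity)
  -- the three engine applications
  have engF := eng (Skeleton.P3 D) (29 * κ * (146 * κ))
    (94 * alpha D * κ * (146 * κ) + 29 * κ * (449 * alpha D * κ)) FF hP3two hP3P (by positivity)
    (by positivity) (fun t ht => (bF t ⟨ht.1, by rw [hT]; linarith [ht.2]⟩).1)
    (fun t ht => (bF t ⟨ht.1, by rw [hT]; linarith [ht.2]⟩).2.1)
    (fun t ht => (bF t ⟨ht.1, by rw [hT]; linarith [ht.2]⟩).2.2)
  have engG1 := eng (Skeleton.P2 D) (29 * κ * (146 * κ))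
    (94 * alpha D * κ * (146 * κ) + 29 * κ * (449 * alpha D * κ)) GG hP2two hP2P (by positivity)
    (by positivity) (fun t ht => (bG t ⟨ht.1, by rw [hT]; linarith [ht.2]⟩).1)
    (fun t ht => (bG t ⟨ht.1, by rw [hT]; linarith [ht.2]⟩).2.1)
    (fun t ht => (bG t ⟨ht.1, by rw [hT]; linarith [ht.2]⟩).2.2)
  have engG2 := eng (Skeleton.P3 D) (29 * κ * (146 * κ))
    (94 * alpha D * κ * (146 * κ) + 29 * κ * (449 * alpha D * κ)) GG hP3two hP3P (by positivity)
    (by positivity) (fun t ht => (bG t ⟨ht.1, by rw [hT]; linarith [ht.2]⟩).1)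
    (fun t ht => (bG t ⟨ht.1, by rw [hT]; linarith [ht.2]⟩).2.1)
    (fun t ht => (bG t ⟨ht.1, by rw [hT]; linarith [ht.2]⟩).2.2)
  -- numeric size of the errors
  have errF := errF_le_ps15 (C := C) hℓ3 hκ0 hκ10
  rw [← hα] at errF
  have htot := total_err_le_ps15 hℓ3 hε hQ0 hCQ
  -- names
  set Ld : ℂ := deriv χ.LFunction 1 ^ 2 with hLd
  set w : ℕ → ℂ := fun n => (‖χ (n : ZMod D)‖ : ℂ) * lamZero c' D j n / (Nat.totient n : ℂ) with hw
  set N2 : ℕ := ⌈Skeleton.P2 D⌉₊ with hN2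
  set N3 : ℕ := ⌈Skeleton.P3 D⌉₊ with hN3
  have hN32 : N3 ≤ N2 := Nat.ceil_mono hP32
  have hN3one : 1 ≤ N3 := Nat.one_le_ceil_iff.mpr (by linarith)
  set SF : ℂ := ∑ n ∈ Finset.Ico 1 N3, w n * FF n with hSF
  set SG1 : ℂ := ∑ n ∈ Finset.Ico 1 N2, w n * GG n with hSG1
  set SG2 : ℂ := ∑ n ∈ Finset.Ico 1 N3, w n * GG n with hSG2
  set SG : ℂ := ∑ n ∈ Finset.Ico N3 N2, w n * GG n with hSG
  set IF : ℂ := ∫ t in (1 : ℝ)..Skeleton.P3 D, FF t / t with hIF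
  set IG1 : ℂ := ∫ t in (1 : ℝ)..Skeleton.P2 D, GG t / t with hIG1
  set IG2 : ℂ := ∫ t in (1 : ℝ)..Skeleton.P3 D, GG t / t with hIG2
  set IG : ℂ := ∫ t in Skeleton.P3 D..Skeleton.P2 D, GG t / t with hIG
  have hSG_split : SG = SG1 - SG2 := by
    rw [hSG, hSG1, hSG2, ← Finset.sum_Ico_consecutive _ hN3one hN32]
    ring
  have hGcont : ContinuousOn (fun t : ℝ => GG t / (t : ℂ)) (Set.Icc 1 T) := by
    refine ContinuousOn.div (fun t ht => (bG t ht).1.continuousAt.continuousWithinAt)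
      Complex.continuous_ofReal.continuousOn fun t ht => ?_
    exact_mod_cast (by linarith [ht.1] : t ≠ 0)
  have hIG_split : IG = IG1 - IG2 := by
    rw [hIG, hIG1, hIG2, intervalIntegral.integral_interval_sub_left]
    · exact (hGcont.mono fun t ht => by
        rw [Set.uIcc_of_le (by linarith : (1:ℝ) ≤ Skeleton.P2 D)] at ht
        exact ⟨ht.1, by rw [hT]; linarith [ht.2]⟩).intervalIntegrable
    · exact (hGcont.mono fun t ht => by
        rw [Set.uIcc_of_le (by linarith : (1:ℝ) ≤ Skeleton.P3 D)] at ht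
        exact ⟨ht.1, by rw [hT]; linarith [ht.2]⟩).intervalIntegrable
  -- the main terms are `𝔞·IF` and `𝔞·IG`
  have hIFeq : Section9Statements.int9main c' D j = IF := by
    rw [hIF, Section9Statements.int9main]
  have hIGeq : (Complex.normSq iota4 : ℂ) * Section9Statements.int9tail c' D j = IG := by
    rw [hIG, Section9Statements.int9tail, Complex.normSq_eq_conj_mul_self]
    have hL2ne : (L2 : ℂ) ≠ 0 := by exact_mod_cast hlogP2.ne'
    have hpt : ∀ t : ℝ, GG t / (t : ℂ) = (conj iota4 * iota4 / (L2 : ℂ) ^ 2) *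
        (frakfW c' D j 7 (Skeleton.P2 D / t) * frakgW c' D j 7 (Skeleton.P2 D / t) / (t : ℂ)) := by
      intro t; simp only [hGG]; ring
    rw [intervalIntegral.integral_congr (g := fun t : ℝ => (conj iota4 * iota4 / (L2 : ℂ) ^ 2) *
        (frakfW c' D j 7 (Skeleton.P2 D / t) * frakgW c' D j 7 (Skeleton.P2 D / t) / (t : ℂ)))
        (fun t _ => hpt t),
      intervalIntegral.integral_const_mul]
    have e2 : ((Real.log (Skeleton.P2 D) : ℝ) : ℂ) = (L2 : ℂ) := by rw [hL2def]
    rw [e2]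
    field_simp
  -- assemble
  rw [hIFeq, hIGeq]
  have key : Ld * SF + Ld * SG - (frakA χ : ℂ) * (IF + IG) =
      (Ld * SF - (frakA χ : ℂ) * IF) +
        ((Ld * SG1 - (frakA χ : ℂ) * IG1) - (Ld * SG2 - (frakA χ : ℂ) * IG2)) := by
    rw [hSG_split, hIG_split]; ring
  have engF' : ‖Ld * SF - (frakA χ : ℂ) * IF‖ ≤ |C| * (423400 + 2674500 * π) / ell D ^ 12 :=
    engF.trans errF
  have engG1' : ‖Ld * SG1 - (frakA χ : ℂ) * IG1‖ ≤ |C| * (423400 + 2674500 * π) / ell D ^ 12 :=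
    engG1.trans errF
  have engG2' : ‖Ld * SG2 - (frakA χ : ℂ) * IG2‖ ≤ |C| * (423400 + 2674500 * π) / ell D ^ 12 :=
    engG2.trans errF
  rw [key]
  calc ‖(Ld * SF - (frakA χ : ℂ) * IF) +
        ((Ld * SG1 - (frakA χ : ℂ) * IG1) - (Ld * SG2 - (frakA χ : ℂ) * IG2))‖
      ≤ ‖Ld * SF - (frakA χ : ℂ) * IF‖ +
        ‖(Ld * SG1 - (frakA χ : ℂ) * IG1) - (Ld * SG2 - (frakA χ : ℂ) * IG2)‖ := norm_add_le _ _
    _ ≤ |C| * (423400 + 2674500 * π) / ell D ^ 12 +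
        (|C| * (423400 + 2674500 * π) / ell D ^ 12 + |C| * (423400 + 2674500 * π) / ell D ^ 12) :=
        add_le_add engF' ((norm_sub_le _ _).trans (add_le_add engG1' engG2'))
    _ = |C| * Q / ell D ^ 12 := by rw [hQ]; ring
    _ ≤ ε / 2 * alpha D := by rw [hα]; exact htot
    _ ≤ ε * alpha D := by nlinarith [hα0]

end Literature.NumberTheory.LFunctions.Zhang2022.Section9PartialSummation

/-! ## The glue at `𝓛⁻¹⁵` -/

namespace Literature.NumberTheory.LFunctions.Zhang2022.Section9FrontEndExact

open Literature.NumberTheory.LFunctions.Zhang2022.Skeleton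
open Literature.NumberTheory.LFunctions.Zhang2022.Section8FrontEnd44Exact

section Glue

variable (c' : ℝ)

/-- Substitution of the gathered `(d,r)`-sums by `n`-sums, guards at `𝓛⁻¹⁵` (twin of `substituted_of_gathered`, verbatim).
[cite: Zhang2022LandauSiegel, §9 p.51; §8 pp.47–48] -/
theorem substituted_of_gathered_pow15 (Φ Ψ : (D : ℕ) → DirichletCharacter ℂ D → ℕ → ℕ → ℂ)
    (hG : ∀ ε : ℝ, 0 < ε → ForAllLarge fun D _ χ => ‖χ.LFunction 1‖ ≤ 1 / Real.log D ^ 15 →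
      ∀ j ∈ ({1, 2, 3} : Finset ℕ),
        ‖Sj c' D j (a12 χ) (a22 χ) -
            (deriv χ.LFunction 1 ^ 2 *
                (∑ n ∈ Finset.Ico 1 ⌈Skeleton.P3 D⌉₊, ∑ p ∈ Nat.divisorsAntidiagonal n,
                  ((ArithmeticFunction.moebius p.2).natAbs : ℂ) *
                        (‖χ ((p.1 * p.2 : ℕ) : ZMod D)‖ : ℂ) /
                      (((p.1 * p.2 : ℕ) : ℂ) * (Nat.totient p.2 : ℂ)) *
                    lamZero c' D j (p.1 * p.2) * PiW χ p.1 p.2 * Φ D χ j n) +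
              deriv χ.LFunction 1 ^ 2 *
                (∑ n ∈ Finset.Ico ⌈Skeleton.P3 D⌉₊ ⌈Skeleton.P2 D⌉₊, ∑ p ∈ Nat.divisorsAntidiagonal n,
                  ((ArithmeticFunction.moebius p.2).natAbs : ℂ) *
                        (‖χ ((p.1 * p.2 : ℕ) : ZMod D)‖ : ℂ) /
                      (((p.1 * p.2 : ℕ) : ℂ) * (Nat.totient p.2 : ℂ)) *
                    lamZero c' D j (p.1 * p.2) * PiW χ p.1 p.2 * Ψ D χ j n))‖
          ≤ ε * alpha D) :
    ∀ ε : ℝ, 0 < ε → ForAllLarge fun D _ χ => ‖χ.LFunction 1‖ ≤ 1 / Real.log D ^ 15 →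
      ∀ j ∈ ({1, 2, 3} : Finset ℕ),
        ‖Sj c' D j (a12 χ) (a22 χ) -
            (deriv χ.LFunction 1 ^ 2 *
                (∑ n ∈ Finset.Ico 1 ⌈Skeleton.P3 D⌉₊,
                  (‖χ (n : ZMod D)‖ : ℂ) * lamZero c' D j n / (Nat.totient n : ℂ) * Φ D χ j n) +
              deriv χ.LFunction 1 ^ 2 *
                (∑ n ∈ Finset.Ico ⌈Skeleton.P3 D⌉₊ ⌈Skeleton.P2 D⌉₊,
                  (‖χ (n : ZMod D)‖ : ℂ) * lamZero c' D j n / (Nat.totient n : ℂ) * Ψ D χ j n))‖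
          ≤ ε * alpha D := by
  intro ε hε
  refine (hG ε hε).mono ?_
  intro D _ χ hq _ h hA j hj
  have key := h hA j hj
  have hP3 : 0 < Skeleton.P3 D := Real.rpow_pos_of_pos (Real.exp_pos _) _
  have h1 : ∀ n ∈ Finset.Ico 1 ⌈Skeleton.P3 D⌉₊, n ≠ 0 := fun n hn => by
    rw [Finset.mem_Ico] at hn; omega
  have h2 : ∀ n ∈ Finset.Ico ⌈Skeleton.P3 D⌉₊ ⌈Skeleton.P2 D⌉₊, n ≠ 0 := fun n hn => by
    rw [Finset.mem_Ico] at hn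
    have : 0 < ⌈Skeleton.P3 D⌉₊ := Nat.ceil_pos.mpr hP3
    omega
  have h810 := Section8FrontEnd810.eq810_holds D χ hq
  rw [Finset.sum_congr rfl (fun n hn =>
      Section8FrontEnd810.sum_antidiagonal_weight χ c' j h810 (h1 n hn) (Φ D χ j n)),
    Finset.sum_congr rfl (fun n hn =>
      Section8FrontEnd810.sum_antidiagonal_weight χ c' j h810 (h2 n hn) (Ψ D χ j n))] at key
  exact key

/-- **§9.u004 (reading (r)) from (G9) and (PS9), guards at `𝓛⁻¹⁵`** (twin of `step9u004r_of_parts`, verbatim; conclusion = the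
body of `Section9Statements.Step9u004r c′` with guard `‖L(1,χ)‖ ≤ 𝓛⁻¹⁵`). [cite: Zhang2022LandauSiegel, §9 p.51, tex L2613–L2618] -/
theorem step9u004r_of_parts_pow15
    (hG : ∀ ε : ℝ, 0 < ε → ForAllLarge fun D _ χ => ‖χ.LFunction 1‖ ≤ 1 / Real.log D ^ 15 →
      ∀ j ∈ ({1, 2, 3} : Finset ℕ),
        ‖Sj c' D j (a12 χ) (a22 χ) -
            (deriv χ.LFunction 1 ^ 2 *
                (∑ n ∈ Finset.Ico 1 ⌈Skeleton.P3 D⌉₊, ∑ p ∈ Nat.divisorsAntidiagonal n,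
                  ((ArithmeticFunction.moebius p.2).natAbs : ℂ) *
                        (‖χ ((p.1 * p.2 : ℕ) : ZMod D)‖ : ℂ) /
                      (((p.1 * p.2 : ℕ) : ℂ) * (Nat.totient p.2 : ℂ)) *
                    lamZero c' D j (p.1 * p.2) * PiW χ p.1 p.2 *
                    ((conj iota3 * frakfW c' D j 6 (Skeleton.P3 D / n) / (Real.log (Skeleton.P3 D) : ℂ) +
                        conj iota4 * frakfW c' D j 7 (Skeleton.P2 D / n) / (Real.log (Skeleton.P2 D) : ℂ)) *
                      (iota3 * frakgW c' D j 6 (Skeleton.P3 D / n) / (Real.log (Skeleton.P3 D) : ℂ) +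
                        iota4 * frakgW c' D j 7 (Skeleton.P2 D / n) / (Real.log (Skeleton.P2 D) : ℂ)))) +
              deriv χ.LFunction 1 ^ 2 *
                (∑ n ∈ Finset.Ico ⌈Skeleton.P3 D⌉₊ ⌈Skeleton.P2 D⌉₊, ∑ p ∈ Nat.divisorsAntidiagonal n,
                  ((ArithmeticFunction.moebius p.2).natAbs : ℂ) *
                        (‖χ ((p.1 * p.2 : ℕ) : ZMod D)‖ : ℂ) /
                      (((p.1 * p.2 : ℕ) : ℂ) * (Nat.totient p.2 : ℂ)) *
                    lamZero c' D j (p.1 * p.2) * PiW χ p.1 p.2 *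
                    (conj iota4 * frakfW c' D j 7 (Skeleton.P2 D / n) / (Real.log (Skeleton.P2 D) : ℂ) *
                      (iota4 * frakgW c' D j 7 (Skeleton.P2 D / n) / (Real.log (Skeleton.P2 D) : ℂ)))))‖
          ≤ ε * alpha D)
    (hPS : ∀ ε : ℝ, 0 < ε → ForAllLarge fun D _ χ => ‖χ.LFunction 1‖ ≤ 1 / Real.log D ^ 15 →
      ∀ j ∈ ({1, 2, 3} : Finset ℕ),
        ‖(deriv χ.LFunction 1 ^ 2 *
                (∑ n ∈ Finset.Ico 1 ⌈Skeleton.P3 D⌉₊,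
                  (‖χ (n : ZMod D)‖ : ℂ) * lamZero c' D j n / (Nat.totient n : ℂ) *
                    ((conj iota3 * frakfW c' D j 6 (Skeleton.P3 D / n) / (Real.log (Skeleton.P3 D) : ℂ) +
                        conj iota4 * frakfW c' D j 7 (Skeleton.P2 D / n) / (Real.log (Skeleton.P2 D) : ℂ)) *
                      (iota3 * frakgW c' D j 6 (Skeleton.P3 D / n) / (Real.log (Skeleton.P3 D) : ℂ) +
                        iota4 * frakgW c' D j 7 (Skeleton.P2 D / n) / (Real.log (Skeleton.P2 D) : ℂ)))) +
              deriv χ.LFunction 1 ^ 2 *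
                (∑ n ∈ Finset.Ico ⌈Skeleton.P3 D⌉₊ ⌈Skeleton.P2 D⌉₊,
                  (‖χ (n : ZMod D)‖ : ℂ) * lamZero c' D j n / (Nat.totient n : ℂ) *
                    (conj iota4 * frakfW c' D j 7 (Skeleton.P2 D / n) / (Real.log (Skeleton.P2 D) : ℂ) *
                      (iota4 * frakgW c' D j 7 (Skeleton.P2 D / n) / (Real.log (Skeleton.P2 D) : ℂ))))) -
            (frakA χ : ℂ) * (Section9Statements.int9main c' D j +
              (Complex.normSq iota4 : ℂ) * Section9Statements.int9tail c' D j)‖ ≤ ε * alpha D) :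
    ∀ ε : ℝ, 0 < ε → Skeleton.ForAllLarge fun D _ χ => ‖χ.LFunction 1‖ ≤ 1 / Real.log D ^ 15 →
      ∀ j ∈ ({1, 2, 3} : Finset ℕ),
        ‖Skeleton.Sj c' D j (Skeleton.a12 χ) (Skeleton.a22 χ) -
            (Skeleton.frakA χ : ℂ) * (Section9Statements.int9main c' D j + (Complex.normSq iota4 : ℂ) * Section9Statements.int9tail c' D j)‖ ≤
          ε * Skeleton.alpha D := by
  intro ε hε
  have hS := substituted_of_gathered_pow15 c'
    (fun D χ j n =>
      (conj iota3 * frakfW c' D j 6 (Skeleton.P3 D / n) / (Real.log (Skeleton.P3 D) : ℂ) +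
          conj iota4 * frakfW c' D j 7 (Skeleton.P2 D / n) / (Real.log (Skeleton.P2 D) : ℂ)) *
        (iota3 * frakgW c' D j 6 (Skeleton.P3 D / n) / (Real.log (Skeleton.P3 D) : ℂ) +
          iota4 * frakgW c' D j 7 (Skeleton.P2 D / n) / (Real.log (Skeleton.P2 D) : ℂ)))
    (fun D χ j n =>
      conj iota4 * frakfW c' D j 7 (Skeleton.P2 D / n) / (Real.log (Skeleton.P2 D) : ℂ) *
        (iota4 * frakgW c' D j 7 (Skeleton.P2 D / n) / (Real.log (Skeleton.P2 D) : ℂ)))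
    hG (ε / 2) (by positivity)
  refine (hS.and (hPS (ε / 2) (by positivity))).mono ?_
  intro D _ χ _ _ ⟨h1, h2⟩ hA j hj
  have e1 := h1 hA j hj
  have e2 := h2 hA j hj
  calc _ = ‖(Sj c' D j (a12 χ) (a22 χ) - _) + (_ - (frakA χ : ℂ) *
        (Section9Statements.int9main c' D j +
          (Complex.normSq iota4 : ℂ) * Section9Statements.int9tail c' D j))‖ := by
        congr 1; ring
    _ ≤ _ := norm_add_le _ _
    _ ≤ ε / 2 * alpha D + ε / 2 * alpha D := add_le_add e1 e2
    _ = ε * alpha D := by ring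

end Glue

end Literature.NumberTheory.LFunctions.Zhang2022.Section9FrontEndExact

/-! ## The node §9.u004 at `𝓛⁻¹⁵` -/

namespace Literature.NumberTheory.LFunctions.Zhang2022.Section9Gathering

open Literature.NumberTheory.LFunctions.Zhang2022.Skeleton
open Literature.NumberTheory.LFunctions.Zhang2022.Repair.Bed (AssumptionAWith)

/-- **`Z22:§9.u004` (reading (r)) UNDER THE MINIMUM PREMISE, UNCONDITIONAL** (`c′ ≥ 0`): the body of
`Section9Statements.Step9u004r c′` with its guard `AssumptionA D χ` replaced by `‖L(1,χ)‖ ≤ 𝓛⁻¹⁵` —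
`step9u004r_of_parts_pow15` at `gathering9_pow15` and `ps9_pow15`. [cite: Zhang2022LandauSiegel, §9 p.51, tex L2613–L2618] -/
theorem step9u004r_pow15 {c' : ℝ} (hc' : 0 ≤ c') :
    ∀ ε : ℝ, 0 < ε → Skeleton.ForAllLarge fun D _ χ => ‖χ.LFunction 1‖ ≤ 1 / Real.log D ^ 15 →
      ∀ j ∈ ({1, 2, 3} : Finset ℕ),
        ‖Skeleton.Sj c' D j (Skeleton.a12 χ) (Skeleton.a22 χ) -
            (Skeleton.frakA χ : ℂ) * (Section9Statements.int9main c' D j + (Complex.normSq iota4 : ℂ) * Section9Statements.int9tail c' D j)‖ ≤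
          ε * Skeleton.alpha D :=
  Section9FrontEndExact.step9u004r_of_parts_pow15 c' (gathering9_pow15 hc')
    (Section9PartialSummation.ps9_pow15 c')

/-- **`Z22:§9.u004` under `Repair.Bed.AssumptionAWith E`, every real `E ≥ 15`, UNCONDITIONAL** (`c′ ≥ 0`; transfer per `ε`; at
the printed `E = 2022` the body of `Section9Statements.Step9u004r c′`, i.e. of the tree theorem `Skeleton.step9u004r_of_lemma84Rel
… (lemma84Rel_holds c′)`, not restated). [cite: Zhang2022LandauSiegel, §9 p.51] -/
theorem step9u004r_of_assumptionAWith {c' : ℝ} (hc' : 0 ≤ c') {E : ℝ} (hE : 15 ≤ E) :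
    ∀ ε : ℝ, 0 < ε → Skeleton.ForAllLarge fun D _ χ => Repair.Bed.AssumptionAWith E D χ →
      ∀ j ∈ ({1, 2, 3} : Finset ℕ),
        ‖Skeleton.Sj c' D j (Skeleton.a12 χ) (Skeleton.a22 χ) -
            (Skeleton.frakA χ : ℂ) * (Section9Statements.int9main c' D j + (Complex.normSq iota4 : ℂ) * Section9Statements.int9tail c' D j)‖ ≤
          ε * Skeleton.alpha D := by
  intro ε hε
  exact Repair.Gap.forAllLarge_assumptionAWith_of_pow15 hE (step9u004r_pow15 hc' ε hε)

end Literature.NumberTheory.LFunctions.Zhang2022.Section9Gathering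

end
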